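import Summits.Ventures.PercRepro.S1NullityOneCircuit
import Summits.Ventures.PercRepro.S1SplitSeparatorConsumers

/-!
# PercRepro — EVERY `1`-SEPARABLE `(9, 5)` CORE SATISFIES THE `(9, 4)` BODY (p2, gen 28; SUBCLAIM-S1 §6.10
(xvii)(k))

THE CAPSTONE of the separator chain. Let `M` be a finite coloop-free matroid of rank `9` on `14` points whose
pairs of distinct points all have rank `2` (a simple coloop-free matroid — the shape of a `(9, 5)` core), and let
`A` be a proper separator (`∅ ≠ A ≠ E`, `ρ(A) + ρ(E ∖ A) = ρ(E)`). Both parts are coloop-free, hence dependent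
(`|A| ≥ ρ(A) + 1`, `|E ∖ A| ≥ ρ(E ∖ A) + 1`), and of rank `≥ 2`; the nullities add up to `5`, so one part is a
circuit (nullity `1`) or the nullities are `(2, 3)` / `(3, 2)`. Every case is one of the consumers already
proved: a circuit separator of `≥ 4` elements, a triangle separator, or one of the six `(ρ(corank-3 part),
ρ(corank-2 part))` shapes `(2, 7)`, `(3, 6)`, `(4, 5)`, `(5, 4)`, `(6, 3)`, `(7, 2)`. Then `ThmN.RLS M 9 4`.
Nothing is claimed about any cell: the CONNECTED `(9, 5)` cores stay open.

* `eRank_add_one_le_ncard_of_coloops` — a coloop-free matroid with a nonempty ground set is dependent;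
* `eRk_add_one_le_ncard_of_separator` — the same for a separator part;
* `isCircuit_of_separator_of_ncard_eq` — a separator part of nullity `1` is a circuit of `M`;
* **`rls_nine_four_of_separator`** — the capstone.
Axioms: standard.
-/

open scoped Matroid

namespace PercRepro

namespace S1

open Set

variable {α : Type}

/-- A coloop-free matroid with a nonempty ground set is dependent: `ρ(E) + 1 ≤ |E|`. -/
theorem eRank_add_one_le_ncard_of_coloops (M : Matroid α) [M.Finite] {r : ℕ} (hr : M.eRank = (r : ℕ∞))
    (hcol : M.coloops = ∅) (hne : M.E.Nonempty) : r + 1 ≤ M.E.ncard := by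
  rcases Nat.eq_zero_or_pos r with h0 | hpos
  · rw [h0]
    exact (ncard_pos M.ground_finite).mpr hne
  · have h := sub_add_one_le_ncard_ground_sdiff_of_coloops M hr hcol (X := ∅) (empty_subset _)
      (by rw [M.eRk_empty]; rfl) hpos
    rwa [sdiff_empty, Nat.sub_zero] at h

/-- A separator part of a coloop-free matroid is dependent: `ρ(A) + 1 ≤ |A|`. -/
theorem eRk_add_one_le_ncard_of_separator (M : Matroid α) [M.Finite] {A : Set α} (hA : A ⊆ M.E)
    (hsep : M.eRk A + M.eRk (M.E \ A) = M.eRank) (hcol : M.coloops = ∅) (hne : A.Nonempty) {k : ℕ}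
    (hk : M.eRk A = (k : ℕ∞)) : k + 1 ≤ A.ncard := by
  haveI : (M ↾ A).Finite := Matroid.restrict_finite (M.ground_finite.subset hA)
  have h := eRank_add_one_le_ncard_of_coloops (M ↾ A) (r := k) (by rw [Matroid.eRank_restrict]; exact hk)
    (restrict_coloops_eq_empty_of_separator M hA hsep hcol) (by rw [Matroid.restrict_ground_eq]; exact hne)
  rwa [Matroid.restrict_ground_eq] at h

/-- A separator part of nullity `1` in a coloop-free matroid is a circuit of `M`. -/
theorem isCircuit_of_separator_of_ncard_eq (M : Matroid α) [M.Finite] {A : Set α} (hA : A ⊆ M.E)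
    (hsep : M.eRk A + M.eRk (M.E \ A) = M.eRank) (hcol : M.coloops = ∅) {k : ℕ} (hk : M.eRk A = (k : ℕ∞))
    (hA1 : A.ncard = k + 1) : M.IsCircuit A := by
  haveI : (M ↾ A).Finite := Matroid.restrict_finite (M.ground_finite.subset hA)
  have h := isCircuit_ground_of_ncard_eq_eRank_add_one (M ↾ A) (r := k)
    (by rw [Matroid.eRank_restrict]; exact hk) (by rw [Matroid.restrict_ground_eq]; exact hA1)
    (restrict_coloops_eq_empty_of_separator M hA hsep hcol)
  rw [Matroid.restrict_ground_eq, Matroid.restrict_isCircuit_iff hA] at h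
  exact h.1

/-- A separator part with at least two points has rank `≥ 2` when all pairs have rank `2`; a single point
cannot be a separator part of nullity `≥ 1` (it would be a loop, and a pair through it would have rank `≤ 1`). -/
theorem two_le_of_separator_part (M : Matroid α) [M.Finite] {A : Set α} (hA : A ⊆ M.E)
    (hpairs : ∀ e ∈ M.E, ∀ f ∈ M.E, e ≠ f → M.eRk {e, f} = 2) (hne : (M.E \ A).Nonempty) {k : ℕ}
    (hk : M.eRk A = (k : ℕ∞)) (hdep : k + 1 ≤ A.ncard) : 2 ≤ k := by
  rcases Nat.lt_or_ge A.ncard 2 with h | h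
  · -- `A = {e}` with `ρ(A) = 0`: a loop
    have hA1 : A.ncard = 1 := by omega
    have hk0 : k = 0 := by omega
    obtain ⟨e, rfl⟩ := ncard_eq_one.mp hA1
    obtain ⟨f, hf⟩ := hne
    have hef : e ≠ f := fun h => hf.2 (by rw [← h]; exact mem_singleton e)
    have h2 := hpairs e (hA (mem_singleton e)) f hf.1 hef
    have hle : M.eRk {e, f} ≤ M.eRk {e} + M.eRk {f} := by
      rw [show ({e, f} : Set α) = {e} ∪ {f} from rfl]
      exact M.eRk_union_le_eRk_add_eRk _ _
    rw [hk0] at hk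
    rw [h2, hk] at hle
    have h1 := M.eRk_singleton_le f
    have : (2 : ℕ∞) ≤ 1 := le_trans hle (by rw [Nat.cast_zero, zero_add]; exact h1)
    exact absurd this (by decide)
  · have := two_le_eRk_of_two_le_ncard hpairs hA h
    rw [hk] at this
    exact_mod_cast this

/-- **THE CAPSTONE**: a finite coloop-free matroid of rank `9` on `14` points with all pairs of rank `2` that
has a proper separator satisfies `ThmN.RLS M 9 4` — every `1`-separable `(9, 5)` core satisfies the `(9, 4)`
body of C-025. -/
theorem rls_nine_four_of_separator (M : Matroid α) [M.Finite] {A : Set α} (hA : A ⊆ M.E) (hne : A.Nonempty)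
    (hne' : (M.E \ A).Nonempty) (hsep : M.eRk A + M.eRk (M.E \ A) = M.eRank)
    (hpairs : ∀ e ∈ M.E, ∀ f ∈ M.E, e ≠ f → M.eRk {e, f} = 2) (hM : M.eRank = ((9 : ℕ) : ℕ∞))
    (hE : M.E.ncard = 14) (hcol : M.coloops = ∅) : ThmN.RLS M 9 4 := by
  have hB : M.E \ A ⊆ M.E := sdiff_subset
  have hAA : M.E \ (M.E \ A) = A := sdiff_sdiff_cancel_left hA
  have hsep' : M.eRk (M.E \ A) + M.eRk (M.E \ (M.E \ A)) = M.eRank := by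
    rw [hAA, add_comm]; exact hsep
  have hne'' : (M.E \ (M.E \ A)).Nonempty := by rw [hAA]; exact hne
  -- the ranks of the parts as naturals
  have hfinA : M.eRk A ≠ ⊤ := ((M.eRk_le_encard _).trans_lt (M.ground_finite.subset hA).encard_lt_top).ne
  have hfinB : M.eRk (M.E \ A) ≠ ⊤ :=
    ((M.eRk_le_encard _).trans_lt (M.ground_finite.subset hB).encard_lt_top).ne
  obtain ⟨k, hk⟩ := ENat.ne_top_iff_exists.mp hfinA
  obtain ⟨l, hl⟩ := ENat.ne_top_iff_exists.mp hfinB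
  have hkA : M.eRk A = (k : ℕ∞) := hk.symm
  have hlB : M.eRk (M.E \ A) = (l : ℕ∞) := hl.symm
  have hkl : k + l = 9 := by
    have h := hsep
    rw [hkA, hlB, hM] at h
    exact_mod_cast h
  -- the sizes
  have hsize : A.ncard + (M.E \ A).ncard = 14 := by
    rw [ncard_sdiff' hA M.ground_finite, hE]
    have := ncard_le_ncard hA M.ground_finite
    rw [hE] at this
    omega
  have hdepA := eRk_add_one_le_ncard_of_separator M hA hsep hcol hne hkA
  have hdepB := eRk_add_one_le_ncard_of_separator M hB hsep' hcol hne' hlB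
  have hk2 := two_le_of_separator_part M hA hpairs hne' hkA hdepA
  have hl2 := two_le_of_separator_part M hB hpairs hne'' hlB hdepB
  have hpairsA : ∀ e ∈ A, ∀ f ∈ A, e ≠ f → M.eRk {e, f} = 2 := fun e he f hf hef =>
    hpairs e (hA he) f (hA hf) hef
  have hpairsB : ∀ e ∈ M.E \ A, ∀ f ∈ M.E \ A, e ≠ f → M.eRk {e, f} = 2 := fun e he f hf hef =>
    hpairs e (hB he) f (hB hf) hef
  -- the two circuit cases
  rcases Nat.lt_or_ge A.ncard (k + 2) with hcA | hcA
  · have hA1 : A.ncard = k + 1 := by omega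
    have hC := isCircuit_of_separator_of_ncard_eq M hA hsep hcol hkA hA1
    have hsepC : M.eRk (M.E \ A) + M.eRk A = M.eRank := by rw [add_comm]; exact hsep
    rcases Nat.lt_or_ge A.ncard 4 with h4 | h4
    · exact rls_nine_four_of_triangle_separator_of_ncard M hC hsepC (by omega) hM hE
    · exact rls_nine_four_of_circuit_separator M hC hsepC h4 hM hcol
  rcases Nat.lt_or_ge (M.E \ A).ncard (l + 2) with hcB | hcB
  · have hB1 : (M.E \ A).ncard = l + 1 := by omega
    have hC := isCircuit_of_separator_of_ncard_eq M hB hsep' hcol hlB hB1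
    have hsepC : M.eRk (M.E \ (M.E \ A)) + M.eRk (M.E \ A) = M.eRank := by rw [add_comm]; exact hsep'
    rcases Nat.lt_or_ge (M.E \ A).ncard 4 with h4 | h4
    · exact rls_nine_four_of_triangle_separator_of_ncard M hC hsepC (by omega) hM hE
    · exact rls_nine_four_of_circuit_separator M hC hsepC h4 hM hcol
  -- the split cases: nullities `(2, 3)` or `(3, 2)`
  have hk7 : k ≤ 7 := by omega
  have hnull : A.ncard = k + 2 ∨ A.ncard = k + 3 := by omega
  interval_cases k
  · -- `k = 2`: `A` is a `4`- or `5`-point line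
    rcases hnull with h | h
    · exact rls_nine_four_of_four_point_line_separator M hA hsep h hkA hpairs hM hE
    · exact rls_nine_four_of_five_point_line_separator M hA hsep h hkA hpairs hM hE
  · -- `k = 3`: `A` of `5` points (the `(6, 3)` split) or `6` points (the `(3, 6)` split)
    rcases hnull with h | h
    · exact rls_nine_four_of_six_three_separator M hA hsep h hkA hpairsA hM hE
    · exact rls_nine_four_of_three_six_separator M hA hsep h hkA hpairs hM hE hcol
  · -- `k = 4`: `A` of `6` points (the `(5, 4)` split) or `7` points (the `(4, 5)` split)
    rcases hnull with h | h
    · exact rls_nine_four_of_five_four_separator M hA hsep h hkA hpairsA hM hE hcol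
    · exact rls_nine_four_of_four_five_separator M hA hsep h hkA hpairs hM hE hcol
  · -- `k = 5`: the complement has rank `4` and `7` or `6` points
    have hlB' : M.eRk (M.E \ A) = ((4 : ℕ) : ℕ∞) := by rw [hlB]; congr 1; omega
    rcases hnull with h | h
    · exact rls_nine_four_of_four_five_separator M hB hsep' (by omega) hlB' hpairs hM hE hcol
    · exact rls_nine_four_of_five_four_separator M hB hsep' (by omega) hlB' hpairsB hM hE hcol
  · -- `k = 6`: the complement has rank `3` and `6` or `5` points
    have hlB' : M.eRk (M.E \ A) = ((3 : ℕ) : ℕ∞) := by rw [hlB]; congr 1; omega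
    rcases hnull with h | h
    · exact rls_nine_four_of_three_six_separator M hB hsep' (by omega) hlB' hpairs hM hE hcol
    · exact rls_nine_four_of_six_three_separator M hB hsep' (by omega) hlB' hpairsB hM hE
  · -- `k = 7`: the complement is a `5`- or `4`-point line
    have hlB' : M.eRk (M.E \ A) = ((2 : ℕ) : ℕ∞) := by rw [hlB]; congr 1; omega
    rcases hnull with h | h
    · exact rls_nine_four_of_five_point_line_separator M hB hsep' (by omega) hlB' hpairs hM hE
    · exact rls_nine_four_of_four_point_line_separator M hB hsep' (by omega) hlB' hpairs hM hE

end S1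

end PercRepro
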